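import Literature.InformationTheory.QuantumCodes.RefinedLPBoundAdditive
import HarnessLib

/-!
# CRSS's refined linear program for the PAIR (C, C′): the refined enumerator of `(C′)⊥` (even subcode) joins the system

Topic `Literature/InformationTheory/QuantumCodes` (venture QEC, cell `qec`, row 06 / rung X1). Calderbank–Rains–Shor–Sloane
bound additive codes by the linear program of Thm. 21, whose unknowns include the weight distribution of `(C′)⊥` for the
even subcode `C′` («Finally, the even weight vectors in `C` form an additive subcode `C′` … constraint (21) expresses
the fact that `C⊥ ⊆ (C′)⊥`» [CalderbankEtAl1998, §7 proof of Thm. 21, printed p. 26]), and sharpen it in §7 (ii) by the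
weight enumerator REFINED with respect to a codeword `u₀` («`R_{C⊥} = (1/|C|) R_C(x₀+3x₁, x₀−x₁, y₀+y₁+2y₂, y₀+y₁−2y₂,
y₀−y₁)`», printed p. 28; the remaining special bounds of Table III are covered by «(iii) Similar arguments eliminate …»).
`RefinedLPBoundAdditive.lean` types the refined system for the pair `(C, C⊥)`. THIS file applies the SAME refined
MacWilliams identity (`RefinedWeightEnumerator.card_mul_refEnum_sympDual`, proved for every subspace) to the even
subcode: when `u₀` has EVEN weight it lies in `C′`, and the pair `(C′, (C′)⊥)` carries a third refined distribution
`R″ = refDist (C′)⊥ u₀` with `|C′| · R″(x) = R_{C′}(T x)`, `R_{C′}` = the even-weight classes of `R_C`, marginals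
`Σ_{a+b+c=j} R″ = W_j` (the `(C′)⊥` unknowns of Thm. 21), `c` even, translation symmetry, and `R′ ≤ R″`
(`C⊥ ⊆ (C′)⊥`, eq. (21) refined). In the tree's vocabulary this is literally a second instance of `CRSSRefinedSystem`
— at `(n, k + e, 1, w₀)` with `A ↦ evenPart A`, `B ↦ W`, `R ↦ evenPart₃ R`, `R′ ↦ R″` (`2^e = [C : C′]`) — linked to
the first by `R′ ≤ R″`:

* `evenPart`, `evenPart₃` — the even(-weight) part of a distribution;
* `CRSSRefinedPairFeasible n k d w₀` — `∃ A B W e R R′ R″`, plain system ∧ refined system ∧ refined system of the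
  even subcode ∧ link;
* `IsAdditiveCode.crssRefinedSystem` (the refined system with its witnesses NAMED), `IsAdditiveCode.crssRefinedSystem_evenSub`,
  `IsAdditiveCode.crssRefinedPairFeasible` (every additive code containing a word of even weight `w₀` solves it) and
  the nonexistence principle `IsAdditiveCode.wtDist_eq_zero_of_not_crssRefinedPairFeasible`.

Column: the system is a definition (the paper's Thm. 21 + §7 (ii), the refinement applied verbatim to the paper's own
subcode `C′`); the feasibility theorems are PROVED. Deliberately NOT here: certificates (Summits-side
`Census/RefinedPairCertificate.lean`), any specific `(n,k,d)`. HONEST FRAMING: necessary conditions for existence;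
nothing here certifies a distance. Reference: [CalderbankEtAl1998] A. R. Calderbank, E. M. Rains, P. W. Shor,
N. J. A. Sloane, IEEE Trans. Inform. Theory 44 (1998) 1369–1387 = arXiv:quant-ph/9608006v5, §7 Thm. 21 (printed p. 26)
and (ii)–(iii) after Thm. 22 (printed p. 28).
-/

namespace Literature.InformationTheory.QuantumCodes

open Finset

/-! ### 1. Even parts -/

/-- The even part of a sequence: `(evenPart A)_j = A_j` for even `j`, `0` for odd `j` (the weight distribution of
the even subcode `C′` in terms of that of `C`). [cite: CalderbankEtAl1998, §7 proof of Thm. 21 (printed p. 26: «the even weight vectors in C form an additive subcode C′»)] -/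
def evenPart (A : ℕ → ℕ) (j : ℕ) : ℕ := if Even j then A j else 0

/-- The even-weight part of a refined distribution: classes `(a,b,c)` of weight `a + b + c` even (the refined
distribution of `C′` in terms of that of `C`). [cite: CalderbankEtAl1998, §7 proof of Thm. 21 and (ii) (printed pp. 26, 28)] -/
def evenPart₃ (R : ℕ → ℕ → ℕ → ℕ) (a b c : ℕ) : ℕ := if Even (a + b + c) then R a b c else 0

/-! ### 2. The refined system of the pair `(C, C′)` -/

/-- **CRSS's refined LP for the pair `(C, C′)`, with integrality.** There are `A, B, W : ℕ → ℕ`, `e ≤ 1` and refined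
distributions `R, R′, R″ : ℕ³ → ℕ` (of `C`, `C⊥`, `(C′)⊥` relative to a codeword `u₀` of weight `w₀`) such that:
the plain system `CRSSIntSystem n k d A B W e` (Thm. 21 (16)–(21) with integrality); the refined system
`CRSSRefinedSystem n k d w₀ A B R R′` (§7 (ii)); the refined system OF THE EVEN SUBCODE
`CRSSRefinedSystem n (k + e) 1 w₀ (evenPart A) W (evenPart₃ R) R″` — `|C′| = 2^{n−k−e}`, marginals of `R″` are the
`W_j`, the refined identity `2^{n−k−e} R″(x) = R_{C′}(T x)`, parity, support, translation, `R_{C′} ≤ R″` with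
equality in weight `0` — and the link `R′ ≤ R″` (`C⊥ ⊆ (C′)⊥`, eq. (21)). Column: definition.
[cite: CalderbankEtAl1998, §7 Thm. 21 eq. (21) (printed p. 26) and §7 (ii) (printed p. 28)] -/
def CRSSRefinedPairFeasible (n k d w₀ : ℕ) : Prop :=
  ∃ (A B W : ℕ → ℕ) (e : ℕ) (R R' R'' : ℕ → ℕ → ℕ → ℕ),
    CRSSIntSystem n k d A B W e ∧ CRSSRefinedSystem n k d w₀ A B R R' ∧
      CRSSRefinedSystem n (k + e) 1 w₀ (evenPart A) W (evenPart₃ R) R'' ∧ ∀ a b c, R' a b c ≤ R'' a b c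

/-! ### 3. Every additive code with a codeword of even weight `w₀` solves it -/

section Proof

variable {n : ℕ}

open scoped Classical in
/-- The weight distribution of `C′` is the even part of that of `C`.
[cite: CalderbankEtAl1998, §7 proof of Thm. 21 (printed p. 26)] -/
theorem wtDist_evenSub (S : Submodule (ZMod 2) (SympVec n)) (hS : IsSelfOrthogonal S) (j : ℕ) :
    wtDist (evenSub S hS) j = evenPart (fun i => wtDist S i) j := by
  unfold wtDist evenPart
  rw [codeWords_evenSub, Finset.filter_filter]
  split_ifs with h
  · congr 1; ext v; simp only [mem_filter]
    constructor
    · rintro ⟨hv, -, hw⟩; exact ⟨hv, hw⟩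
    · rintro ⟨hv, hw⟩; exact ⟨hv, hw ▸ h, hw⟩
  · rw [Finset.card_eq_zero, Finset.filter_eq_empty_iff]
    rintro v - ⟨hv, hw⟩
    exact h (hw ▸ hv)

open scoped Classical in
/-- The refined distribution of `C′` is the even-weight part of that of `C` (a class `(a,b,c)` has weight
`a + b + c`). [cite: CalderbankEtAl1998, §7 proof of Thm. 21 and (ii) (printed pp. 26, 28)] -/
theorem refDist_evenSub (S : Submodule (ZMod 2) (SympVec n)) (hS : IsSelfOrthogonal S) (u₀ : SympVec n)
    (a b c : ℕ) : refDist (evenSub S hS) u₀ a b c = evenPart₃ (refDist S u₀) a b c := by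
  unfold refDist evenPart₃
  rw [codeWords_evenSub, Finset.filter_filter]
  split_ifs with h
  · congr 1; ext v; simp only [mem_filter]
    constructor
    · rintro ⟨hv, -, hw⟩; exact ⟨hv, hw⟩
    · rintro ⟨hv, hw⟩
      refine ⟨hv, ?_, hw⟩
      rw [sympWeight_eq_offWt_add u₀ v, hw.1, hw.2.1, hw.2.2]; exact h
  · rw [Finset.card_eq_zero, Finset.filter_eq_empty_iff]
    rintro v - ⟨hv, ha, hb, hc⟩
    apply h
    rw [← ha, ← hb, ← hc, ← sympWeight_eq_offWt_add u₀ v]; exact hv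

open scoped Classical in
/-- The refined distribution is monotone in the code: `T ≤ S ⇒ refDist T ≤ refDist S` entrywise (used for
`C⊥ ⊆ (C′)⊥`). [cite: CalderbankEtAl1998, §7 Thm. 21 eq. (21) (printed p. 26)] -/
theorem refDist_mono {S T : Submodule (ZMod 2) (SympVec n)} (hTS : T ≤ S) (u₀ : SympVec n) (a b c : ℕ) :
    refDist T u₀ a b c ≤ refDist S u₀ a b c := by
  unfold refDist
  refine Finset.card_le_card fun v hv => ?_
  rw [mem_filter, mem_codeWords] at hv ⊢
  exact ⟨hTS hv.1, hv.2⟩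

open scoped Classical in
/-- On a self-orthogonal code containing `u₀`, classes with odd `c` are empty: `refDist C u₀ (a,b,c) = 0` for odd `c`
(`C ⊆ C⊥` and «`c(u) ≡ 0 (mod 2)`» on `C⊥`). [cite: CalderbankEtAl1998, §7 (ii) (printed p. 28)] -/
theorem refDist_eq_zero_of_odd {S : Submodule (ZMod 2) (SympVec n)} (hS : IsSelfOrthogonal S) {u₀ : SympVec n}
    (hu₀ : u₀ ∈ S) {a b c : ℕ} (hc : Odd c) : refDist S u₀ a b c = 0 := by
  have := refDist_le_refDist_sympDual hS u₀ a b c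
  have h0 := refDist_sympDual_eq_zero_of_odd hu₀ hc (a := a) (b := b)
  omega

open scoped Classical in
/-- `|C′| = 2^{n−k−e}` where `2^e = [C : C′]` (`e = evenIndexExp`). [cite: CalderbankEtAl1998, §7 Thm. 21 eq. (20) (printed p. 26: «C′ is either half or all of C»)] -/
theorem card_codeWords_evenSub {k d : ℕ} {S : Submodule (ZMod 2) (SympVec n)} (h : IsAdditiveCode S k d) :
    #(codeWords (evenSub S h.1)) = 2 ^ (n - (k + evenIndexExp S h.1)) := by
  have hS : IsSelfOrthogonal S := h.1
  have hNk : Module.finrank (ZMod 2) S = n - k := by have := h.2.1; omega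
  have hcard : #(codeWords S) = 2 ^ (n - k) := by rw [card_codeWords S, hNk]
  have hce := card_evenSub S hS
  unfold evenIndexExp
  split_ifs with hall
  · rw [hall, hcard, Nat.add_zero]
  · rcases hce with hall' | hhalf
    · exact absurd hall' hall
    · rw [hcard] at hhalf
      have hpos : 0 < #(codeWords (evenSub S hS)) := Finset.card_pos.2 ⟨0, mem_codeWords.2 (evenSub S hS).zero_mem⟩
      rcases Nat.eq_zero_or_pos (n - k) with h0 | hnk
      · rw [h0, pow_zero] at hhalf; omega
      · have : 2 ^ (n - k) = 2 * 2 ^ (n - k - 1) := by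
          rw [← pow_succ']; congr 1; omega
        rw [this] at hhalf
        rw [show n - (k + 1) = n - k - 1 by omega]
        omega

open scoped Classical in
/-- **The refined system with its witnesses named**: for an `[[n,k,d]]` additive code and `u₀ ∈ C`,
`(A, B, R, R′) = (wtDist C, wtDist C⊥, refDist C u₀, refDist C⊥ u₀)` satisfies `CRSSRefinedSystem n k d (wt u₀)` (the
proof of `IsAdditiveCode.crssRefinedFeasible` with the witnesses exposed, so that further refined distributions can be
linked to them). Column: PROVED. [cite: CalderbankEtAl1998, §7 (ii) (printed p. 28)] -/
theorem IsAdditiveCode.crssRefinedSystem {k d : ℕ} {S : Submodule (ZMod 2) (SympVec n)} (h : IsAdditiveCode S k d)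
    {u₀ : SympVec n} (hu₀ : u₀ ∈ S) :
    CRSSRefinedSystem n k d (sympWeight u₀) (fun j => wtDist S j) (fun j => wtDist (sympDual S) j)
      (refDist S u₀) (refDist (sympDual S) u₀) := by
  have hS : IsSelfOrthogonal S := h.1
  have hNk : Module.finrank (ZMod 2) S = n - k := by have := h.2.1; omega
  have hcard : #(codeWords S) = 2 ^ (n - k) := by rw [card_codeWords S, hNk]
  have hu₀' : u₀ ∈ sympDual S := hS hu₀
  refine ⟨?_, ?_, ?_, ?_, ?_, ?_, ?_, ?_, refDist_zero S u₀, refDist_self hu₀⟩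
  · intro j _; exact sum_refDist_eq_wtDist S u₀ j
  · intro j _; exact sum_refDist_eq_wtDist (sympDual S) u₀ j
  · intro x₀ x₁ y₀ y₁ y₂
    rw [refPoly_refDist, refPoly_refDist, ← card_mul_refEnum_sympDual S u₀, hcard]
    push_cast; ring
  · intro a b c hc
    refine ⟨?_, refDist_sympDual_eq_zero_of_odd hu₀ hc⟩
    have := refDist_le_refDist_sympDual hS u₀ a b c
    have h0 := refDist_sympDual_eq_zero_of_odd hu₀ hc (a := a) (b := b)
    omega
  · intro a b c habc
    exact ⟨refDist_eq_zero_of_not_mem habc, refDist_eq_zero_of_not_mem habc⟩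
  · intro a b c hbc
    exact ⟨refDist_translate hu₀ hbc, refDist_translate hu₀' hbc⟩
  · intro a b c; exact refDist_le_refDist_sympDual hS u₀ a b c
  · intro a b c habc; exact refDist_eq_refDist_sympDual h u₀ habc

open scoped Classical in
/-- **The refined system of the even subcode.** For an `[[n,k,d]]` additive code `C` with even subcode `C′`
(`[C : C′] = 2^e`) and a codeword `u₀ ∈ C` of EVEN weight (so `u₀ ∈ C′ ⊆ C ⊆ C⊥ ⊆ (C′)⊥`), the data
`(evenPart A, W, evenPart₃ R, R″) = (wtDist C′, wtDist (C′)⊥, refDist C′ u₀, refDist (C′)⊥ u₀)` satisfy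
`CRSSRefinedSystem n (k + e) 1 (wt u₀)`: `|C′| = 2^{n−k−e}`; the refined MacWilliams identity of §7 (ii) for the pair
`(C′, (C′)⊥)`; `c` is even on `(C′)⊥` because `u₀ ∈ C′`; translation by `u₀ ∈ (C′)⊥` (and on `C′` the parity of
the weight `a + b + c` is translation invariant because `wt u₀` is even); `C′ ⊆ (C′)⊥`; weight `0` carries only the
zero word on both sides. Column: PROVED. [cite: CalderbankEtAl1998, §7 Thm. 21 eqs. (20)–(21) (printed p. 26) and §7 (ii) (printed p. 28)] -/
theorem IsAdditiveCode.crssRefinedSystem_evenSub {k d : ℕ} {S : Submodule (ZMod 2) (SympVec n)}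
    (h : IsAdditiveCode S k d) {u₀ : SympVec n} (hu₀ : u₀ ∈ S) (hev : Even (sympWeight u₀)) :
    CRSSRefinedSystem n (k + evenIndexExp S h.1) 1 (sympWeight u₀) (evenPart fun j => wtDist S j)
      (fun j => wtDist (sympDual (evenSub S h.1)) j) (evenPart₃ (refDist S u₀))
      (refDist (sympDual (evenSub S h.1)) u₀) := by
  have hS : IsSelfOrthogonal S := h.1
  have hu₀' : u₀ ∈ evenSub S hS := ⟨hu₀, hev⟩
  have hu₀'' : u₀ ∈ sympDual (evenSub S hS) := sympDual_anti (evenSub_le S hS) (hS hu₀)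
  have hcard' := card_codeWords_evenSub h
  have hR : evenPart₃ (refDist S u₀) = refDist (evenSub S hS) u₀ := by
    funext a b c; exact (refDist_evenSub S hS u₀ a b c).symm
  have hA : (evenPart fun j => wtDist S j) = fun j => wtDist (evenSub S hS) j := by
    funext j; exact (wtDist_evenSub S hS j).symm
  refine ⟨?_, ?_, ?_, ?_, ?_, ?_, ?_, ?_, ?_, ?_⟩
  -- marginals
  · intro j _; rw [hR, hA]; exact sum_refDist_eq_wtDist (evenSub S hS) u₀ j
  · intro j _; exact sum_refDist_eq_wtDist (sympDual (evenSub S hS)) u₀ j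
  -- the refined MacWilliams identity of the pair `(C′, (C′)⊥)` at integer points
  · intro x₀ x₁ y₀ y₁ y₂
    rw [hR, refPoly_refDist, refPoly_refDist, ← card_mul_refEnum_sympDual (evenSub S hS) u₀, hcard']
    push_cast; ring
  -- parity of `c`
  · intro a b c hc
    refine ⟨?_, refDist_sympDual_eq_zero_of_odd hu₀' hc⟩
    unfold evenPart₃
    split_ifs
    · exact refDist_eq_zero_of_odd hS hu₀ hc
    · rfl
  -- support
  · intro a b c habc
    refine ⟨?_, refDist_eq_zero_of_not_mem habc⟩
    unfold evenPart₃
    split_ifs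
    · exact refDist_eq_zero_of_not_mem habc
    · rfl
  -- translation symmetry (on `C` only classes with even `c` occur; there the weight parity is invariant)
  · intro a b c hbc
    refine ⟨?_, refDist_translate hu₀'' hbc⟩
    unfold evenPart₃
    by_cases hc : Even c
    · have hpar : Even (a + b + c) ↔ Even (a + (sympWeight u₀ - b - c) + c) := by
        obtain ⟨t, ht⟩ := hev
        obtain ⟨s, hs⟩ := hc
        obtain ⟨r, hr⟩ : ∃ r, sympWeight u₀ = b + c + r := ⟨sympWeight u₀ - (b + c), by omega⟩
        have hr' : sympWeight u₀ - b - c = r := by omega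
        rw [hr']
        simp only [Nat.even_iff]
        constructor <;> intro hh <;> omega
      by_cases hE : Even (a + b + c)
      · rw [if_pos hE, if_pos (hpar.1 hE)]; exact refDist_translate hu₀ hbc
      · rw [if_neg hE, if_neg (fun hh => hE (hpar.2 hh))]
    · have hc' : Odd c := Nat.not_even_iff_odd.1 hc
      rw [refDist_eq_zero_of_odd hS hu₀ hc', refDist_eq_zero_of_odd hS hu₀ hc']
      split_ifs <;> rfl
  -- containment `C′ ⊆ (C′)⊥`
  · intro a b c
    unfold evenPart₃
    split_ifs
    · exact refDist_mono (le_trans hS (sympDual_anti (evenSub_le S hS))) u₀ a b c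
    · exact Nat.zero_le _
  -- equality in weight `0`
  · intro a b c habc
    have ha : a = 0 := by omega
    have hb : b = 0 := by omega
    have hc : c = 0 := by omega
    subst ha hb hc
    unfold evenPart₃
    rw [if_pos (by decide), refDist_zero, refDist_zero]
  -- the two unit entries
  · unfold evenPart₃; rw [if_pos (by decide)]; exact refDist_zero S u₀
  · unfold evenPart₃
    rw [if_pos (by simpa using hev)]
    exact refDist_self hu₀

open scoped Classical in
/-- **Every additive code containing a word `u₀` of EVEN weight `w₀` solves the refined system of the pair
`(C, C′)`**: witnesses `(wtDist C, wtDist C⊥, wtDist (C′)⊥, log₂[C:C′], refDist C u₀, refDist C⊥ u₀,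
refDist (C′)⊥ u₀)`; the link `R′ ≤ R″` is `C⊥ ⊆ (C′)⊥` (eq. (21)). Column: PROVED.
[cite: CalderbankEtAl1998, §7 Thm. 21 eq. (21) (printed p. 26) and §7 (ii) (printed p. 28)] -/
theorem IsAdditiveCode.crssRefinedPairFeasible {k d w₀ : ℕ} {S : Submodule (ZMod 2) (SympVec n)}
    (h : IsAdditiveCode S k d) (hw1 : ∀ v ∈ S, sympWeight v ≠ 1) {u₀ : SympVec n} (hu₀ : u₀ ∈ S)
    (hw₀ : sympWeight u₀ = w₀) (hev : Even w₀) : CRSSRefinedPairFeasible n k d w₀ := by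
  subst hw₀
  exact ⟨_, _, _, _, _, _, _, h.crssIntSystem hw1, h.crssRefinedSystem hu₀, h.crssRefinedSystem_evenSub hu₀ hev,
    fun a b c => refDist_mono (sympDual_anti (evenSub_le S h.1)) u₀ a b c⟩

open scoped Classical in
/-- **The refined pair bound as a nonexistence principle.** If for an EVEN weight `w₀` the refined system of the
pair `(C, C′)` is infeasible, then no additive code (without weight-one stabilizer words) has a codeword of weight
`w₀`: `A_{w₀} = 0`. Column: PROVED. [cite: CalderbankEtAl1998, §7 (ii)–(iii) (printed p. 28)] -/
theorem IsAdditiveCode.wtDist_eq_zero_of_not_crssRefinedPairFeasible {k d w₀ : ℕ}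
    {S : Submodule (ZMod 2) (SympVec n)} (h : IsAdditiveCode S k d) (hw1 : ∀ v ∈ S, sympWeight v ≠ 1)
    (hev : Even w₀) (hno : ¬ CRSSRefinedPairFeasible n k d w₀) : wtDist S w₀ = 0 := by
  rw [wtDist, Finset.card_eq_zero, Finset.filter_eq_empty_iff]
  intro v hv hvw
  exact hno (h.crssRefinedPairFeasible hw1 (mem_codeWords.1 hv) hvw hev)

end Proof

end Literature.InformationTheory.QuantumCodes
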